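import Summits.AtomisticToContinuum.HydrodynamicLimit.Theorems.InformationPercolationEngineChaosClosesEulerDissipationRigidityG
import HarnessLib

/-!
# Dissipation rigidity — small entropy production of the smoothed law forces Maxwellian moments

Helper for the line `empirical-h-theorem` (crux-strategist s2; adopted by the lead after the line `Sketch` completed) of the crux
`InformationPercolationEngine.ChaosClosesEuler` (stmt-AtomisticToContinuum-15141), skeleton
`Cruxes/ChaosClosesEuler/Lines/empirical_h_theorem.lean`, registered stub `stub_dissipationRigidity`: body VERBATIM the skeleton def `DissipationRigidity`: on the class {mass ∈ [ρ₁,ρ₂], UI second moments (schedule Lt), θ ≥ θ₁}, at every coarse-graining δ > 0, smallness of the floored/smoothed entropy production `D_{K,L}(m)` forces the ψ-moments of `m` to be those of the Maxwellian of its own fields.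

Proof (helper files `…DissipationRigidityA–G.lean`): by contradiction — negating the quantifier block with
`η = 1/(k+1)`, `K₁ = L₁ = n = k` produces a bad sequence (floors `Kₖ ≥ k`, cuts `Lₖ ≥ k`, measures `mₖ` in the
class at level `k` with `θ(mₖ) ≥ θ₁`, `D_{Kₖ,Lₖ}(mₖ) ≤ 1/(k+1)` and `ψ`-defect `> ε`), which
`false_of_bad_sequence` (file G: Prokhorov extraction, weak-limit toolkit, Fatou on the symmetrised dissipation,
detailed balance and the classification of collision invariants, heat deconvolution, characteristic-function
identification of the limit as a Maxwellian, continuity of the Maxwellian pairing) excludes.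

References: C. Cercignani, R. Illner, M. Pulvirenti (1994) §3.1–3.2 (Boltzmann inequality, collision invariants); folklore (compactness, Gaussian deconvolution).
-/

noncomputable section

namespace Summit.AtomisticToContinuum.HydrodynamicLimit.Theorems.ChaosClosesEulerDissipationRigidity

open scoped BigOperators Topology Classical MeasureTheory ENNReal InnerProductSpace
open Filter Set MeasureTheory
open Literature.MathematicalPhysics.KineticTheory
open Literature.Analysis.FluidPDE
open Summit.AtomisticToContinuum.HydrodynamicLimit.Theses
open Summit.AtomisticToContinuum.HydrodynamicLimit.Theses.InformationPercolationEngine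

/-- Registered stub `stub_dissipationRigidity` of the line `empirical-h-theorem` (crux stmt-AtomisticToContinuum-15141): body VERBATIM the skeleton def `DissipationRigidity`: on the class {mass ∈ [ρ₁,ρ₂], UI second moments (schedule Lt), θ ≥ θ₁}, at every coarse-graining δ > 0, smallness of the floored/smoothed entropy production `D_{K,L}(m)` forces the ψ-moments of `m` to be those of the Maxwellian of its own fields. [folklore] -/
theorem stub_dissipationRigidity :
    ∀ (Lt : ℕ → ℝ) (ρ₁ ρ₂ θ₁ : ℝ), 0 < ρ₁ → 0 < θ₁ →
      ∀ ψ : V3 → ℝ, Continuous ψ → (∃ C : ℝ, ∀ v, |ψ v| ≤ C) → ∀ δ : ℝ, 0 < δ → ∀ ε : ℝ, 0 < ε →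
      ∃ η : ℝ, 0 < η ∧ ∃ K₁ : ℝ, ∀ K : ℝ, K₁ ≤ K → ∃ L₁ : ℝ, ∀ L : ℝ, L₁ ≤ L → ∃ n : ℕ,
      ∀ m : Measure V3, IsFiniteMeasure m → Integrable (fun v : V3 => ‖v‖ ^ 2) m →
        ρ₁ ≤ (m Set.univ).toReal → (m Set.univ).toReal ≤ ρ₂ →
        (∀ j : ℕ, j ≤ n → ∫ v in {v : V3 | Lt j < ‖v‖}, ‖v‖ ^ 2 ∂m ≤ 1 / ((j : ℝ) + 1)) →
      let φδ : V3 → ℝ := fun v => localMaxwellian 1 (δ ^ 2) 0 v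
      let y₀ : V3 → ℝ := fun v => Real.exp (-K) * ((1 + ‖v‖ ^ 2) ^ 2)⁻¹
      let ℓK : V3 → ℝ → ℝ := fun v y => if y₀ v ≤ y then Real.log y else Real.log (y₀ v) + (y - y₀ v) / y₀ v
      let g : V3 → ℝ := fun v => ∫ w, φδ (v - w) ∂m
      let Λt : V3 → ℝ := fun v => ∫ u, φδ (v - u) * ℓK u (g u)
      let Gt : V3 → ℝ := fun v => Real.exp (Λt v)
      let cut : V3 → V3 → ℝ := fun v u => if ‖v‖ ^ 2 + ‖u‖ ^ 2 ≤ L then 1 else 0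
      let D : ℝ := ∫ v, ∫ u, cut v u * (∫ ω : Metric.sphere (0 : V3) 1,
          (Λt v + Λt u - Λt (collide ω (v, u)).1 - Λt (collide ω (v, u)).2) * hardSphereKernel (u, v) ω
            ∂sphereMeasure) * (Gt v * Gt u)
      let ρm : ℝ := (m Set.univ).toReal
      let um : V3 := ρm⁻¹ • ∫ v, v ∂m
      let θm : ℝ := 2 / 3 * ((∫ v, ‖v‖ ^ 2 / 2 ∂m) / ρm - ‖∫ v, v ∂m‖ ^ 2 / (2 * ρm ^ 2))
      θ₁ ≤ θm → D ≤ η → |(∫ v, ψ v ∂m) - ρm * ∫ v, ψ v * localMaxwellian 1 θm um v| ≤ ε := by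
  intro Lt ρ₁ ρ₂ θ₁ hρ₁ hθ₁ ψ hψ hC δ hδ ε hε
  by_contra H
  push Not at H
  -- a bad sequence: `η = 1/(k+1)`, `K₁ = L₁ = n = k`
  have H1 := fun k : ℕ => H (1 / ((k : ℝ) + 1)) (by positivity) k
  choose K hKk hK2 using H1
  have H2 := fun k : ℕ => hK2 k k
  choose L hLk hL2 using H2
  have H3 := fun k : ℕ => hL2 k k
  choose m hfin hint hlo hhi htail hrest using H3
  simp only [Classical.not_imp, not_le] at hrest
  have hK0 : ∀ k, 0 ≤ K k := fun k => (Nat.cast_nonneg k).trans (hKk k)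
  have hKt : Tendsto K atTop atTop :=
    tendsto_atTop_mono hKk tendsto_natCast_atTop_atTop
  have hLt : Tendsto L atTop atTop :=
    tendsto_atTop_mono hLk tendsto_natCast_atTop_atTop
  have hηt : Tendsto (fun k : ℕ => 1 / ((k : ℝ) + 1)) atTop (𝓝 0) := tendsto_one_div_add_atTop_nhds_zero_nat
  exact false_of_bad_sequence Lt hρ₁ hθ₁ hψ hC hδ hε hK0 hKt hLt hηt m hfin hint hlo hhi htail
    (fun k => (hrest k).1) (fun k v => rfl) (fun k v => rfl) (fun k => (hrest k).2.1) (fun k => (hrest k).2.2)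

end Summit.AtomisticToContinuum.HydrodynamicLimit.Theorems.ChaosClosesEulerDissipationRigidity
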